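import Literature.NumberTheory.Automorphic.ArchUnipotentSmoothingGL2
import Literature.NumberTheory.Automorphic.MixedSpaceUnitsHaar
import Mathlib.Analysis.SpecialFunctions.Exponential
import Mathlib.Analysis.Calculus.BumpFunction.FiniteDimension
import HarnessLib

/-!
# The torus smoothing `S_A(φ) v = ∫ φ(u) τ(a(u)) v d^×u` of `GL₂(K_∞)`: absorption of the diagonal letters and exchange with Whittaker-type functionals

Topic `NumberTheory/Automorphic`; namespace `Literature.NumberTheory.Automorphic`. Definitions with
bodies and theorems (no named fact). Companion of `ArchUnipotentSmoothingGL2` (the unipotent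
smoothing `S_U(g)`) for the torus `A = {a(u) = diag(u, 1)}` of the mirabolic subgroup `P₂ = A U` of
`GL₂(K_∞)`, `K_∞ = mixedSpace K`. For a strongly continuous representation `τ` of `GL₂(K_∞)` by
operators of norm `≤ 1` on a Banach space `E` (Gårding space `𝒢`), a measure `μ` on `K_∞ˣ` finite on
compacts, and a kernel `φ` on `K_∞` we set

  `S_A(φ) v = torusSmoothing μ φ v = ∫_{K_∞ˣ} φ(u) • τ(a(u)) v dμ(u)`.

We PROVE:

* `IsTorusKernel φ` — the class of **torus kernels**: `φ ∈ C^∞(K_∞)` of compact support contained in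
  the (open) set of units; it is stable under `φ ↦ -∂_{a·x} φ` (`IsTorusKernel.eulerDeriv`) and under
  multiplication by smooth functions, its members restrict to compactly supported functions on
  `K_∞ˣ` (`IsTorusKernel.hasCompactSupport_comp_val`), and around every unit there is a torus kernel
  equal to `1` (`exists_isTorusKernel_eventually_eq_one`, a `ContDiffBump`);
* `torusSmoothing_mem_archGardingSpace` — `S_A(φ)` preserves the Gårding space
  (`weightedIntegral_apply_toArch_mem_archGardingSpace`), with `‖S_A(φ) v‖ ≤ ‖φ‖_{L¹(μ)} ‖v‖`;
* `archDerivE_single00_torusSmoothing` — **absorption of the diagonal letters** for a left-invariant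
  `μ` and EVERY `v ∈ E`: `τ(E₀₀ ⊗ a) S_A(φ) v = S_A(φ_a) v`, `φ_a(x) = -∂φ(x)(a x)`
  (`e^{s E₀₀⊗a} = a(e^{sa})`, the substitution `u ↦ e^{-sa} u` in the Haar integral, and
  differentiation under the integral sign);
* `apply_torusSmoothing_eq` — **exchange with Sobolev-bounded functionals** (`E` Hilbert): for
  `v ∈ 𝒢` and `ℓ` bounded by finitely many `U(𝔤)`-seminorms,
  `ℓ(S_A(φ) v) = ∫ φ(u) W_v(u) dμ(u)` with `W_v(u) = ℓ(τ(a(u)) v)` the Kirillov function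
  (`ArchKirillovFunctionGL2`), via the exchange lemma `apply_integral_apply_toArch_eq_integral`.

These are the torus halves of the mirabolic smoothing calculus of Jacquet–Shalika (1981), §3,
(3.1)–(3.3), used there (Prop. (3.8) and (3.16)) to control the Kirillov functions of smooth vectors.

## References

* H. Jacquet, J. A. Shalika, *On Euler products and the classification of automorphic
  representations I*, Amer. J. Math. 103 (1981), 499–558, §3 [JacquetShalikaAJM1981].
* J. Arthur, L. Clozel, *Simple Algebras, Base Change, and the Advanced Theory of the Trace Formula*,
  Ann. of Math. Stud. 120 (1989), Ch. 3 §5 (where the archimedean estimate is used)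
  [ArthurClozelAMS120].
-/

noncomputable section

open MeasureTheory Measure NumberField NumberField.mixedEmbedding NumberField.InfinitePlace IsDedekindDomain Set Filter

open scoped MatrixGroups ENNReal NNReal Classical Topology ComplexConjugate Real ContDiff

namespace Literature.NumberTheory.Automorphic

variable {K : Type} [Field K] [NumberField K]

attribute [local instance] glInfBorel borelSpace_glInf locallyCompactSpace_glInf secondCountableTopology_glInf

-- as in `ArchUnipotentSmoothingGL2`
set_option backward.isDefEq.respectTransparency false

/-! ### 1. Torus kernels -/

section Kernel

variable (K) in
/-- **Torus kernels**: smooth functions on `K_∞` whose (compact) support consists of units. Their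
restrictions to `K_∞ˣ` are the test functions we smooth the torus action with. [folklore] -/
structure IsTorusKernel (φ : mixedSpace K → ℂ) : Prop where
  contDiff : ContDiff ℝ ∞ φ
  hasCompactSupport : HasCompactSupport φ
  tsupport_subset : tsupport φ ⊆ {x | IsUnit x}

namespace IsTorusKernel

variable {φ : mixedSpace K → ℂ}

/-- A torus kernel is continuous. [folklore] -/
theorem continuous (hφ : IsTorusKernel K φ) : Continuous φ := hφ.contDiff.continuous

/-- A torus kernel is differentiable. [folklore] -/
theorem differentiable (hφ : IsTorusKernel K φ) : Differentiable ℝ φ := hφ.contDiff.differentiable (by simp)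

/-- The derivative of a torus kernel is continuous. [folklore] -/
theorem continuous_fderiv (hφ : IsTorusKernel K φ) : Continuous (fderiv ℝ φ) := hφ.contDiff.continuous_fderiv (by simp)

/-- The units of `K_∞` lying in the support of a torus kernel form a compact subset of `K_∞ˣ`
(`Units.val` is an open embedding for the Banach algebra `K_∞`). [folklore] -/
theorem isCompact_preimage_val (hφ : IsTorusKernel K φ) :
    IsCompact ((Units.val : (mixedSpace K)ˣ → mixedSpace K) ⁻¹' tsupport φ) :=
  (Units.isOpenEmbedding_val (R := mixedSpace K)).isInducing.isCompact_preimage' hφ.hasCompactSupport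
    fun x hx => by
      obtain ⟨u, hu⟩ := hφ.tsupport_subset hx
      exact ⟨u, hu⟩

/-- **The restriction of a torus kernel to `K_∞ˣ` has compact support.** [folklore] -/
theorem hasCompactSupport_comp_val (hφ : IsTorusKernel K φ) :
    HasCompactSupport fun u : (mixedSpace K)ˣ => φ (u : mixedSpace K) :=
  HasCompactSupport.intro hφ.isCompact_preimage_val fun _ hu => image_eq_zero_of_notMem_tsupport hu

/-- **The Euler derivative `φ_a(x) = -∂φ(x)(a x)` of a torus kernel is a torus kernel.** [folklore] -/
theorem eulerDeriv (hφ : IsTorusKernel K φ) (a : mixedSpace K) :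
    IsTorusKernel K (fun x => -(fderiv ℝ φ x (a * x))) where
  contDiff := by
    have h1 : ContDiff ℝ ∞ (fderiv ℝ φ) := (contDiff_infty_iff_fderiv.1 hφ.contDiff).2
    exact (h1.clm_apply (contDiff_const.mul contDiff_id)).neg
  hasCompactSupport := by
    refine (hφ.hasCompactSupport.fderiv (𝕜 := ℝ)).mono fun x hx => ?_
    rw [Function.mem_support] at hx ⊢
    intro h0
    exact hx (by rw [h0]; simp)
  tsupport_subset := by
    have hsupp : Function.support (fun x => -(fderiv ℝ φ x (a * x))) ⊆ Function.support (fderiv ℝ φ) := by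
      intro x hx
      rw [Function.mem_support] at hx ⊢
      intro h0
      exact hx (by rw [h0]; simp)
    exact (closure_mono hsupp).trans ((tsupport_fderiv_subset ℝ).trans hφ.tsupport_subset)

/-- **Torus kernels are stable under multiplication by smooth functions.** [folklore] -/
theorem mul_left (hφ : IsTorusKernel K φ) {χ : mixedSpace K → ℂ} (hχ : ContDiff ℝ ∞ χ) :
    IsTorusKernel K (fun x => χ x * φ x) where
  contDiff := hχ.mul hφ.contDiff
  hasCompactSupport := hφ.hasCompactSupport.mul_left
  tsupport_subset := tsupport_mul_subset_right.trans hφ.tsupport_subset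

end IsTorusKernel

/-- **Torus kernels equal to `1` near a given unit exist** (a smooth bump of `K_∞` around `u₀` of
radius small enough to consist of units). [folklore] -/
theorem exists_isTorusKernel_eventually_eq_one (u₀ : (mixedSpace K)ˣ) :
    ∃ φ : mixedSpace K → ℂ, IsTorusKernel K φ ∧ ∀ᶠ u : (mixedSpace K)ˣ in 𝓝 u₀, φ (u : mixedSpace K) = 1 := by
  -- a ball of units around `u₀`
  obtain ⟨ε, hε, hball⟩ := Metric.isOpen_iff.1 (Units.isOpen (R := mixedSpace K)) (u₀ : mixedSpace K) u₀.isUnit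
  let b : ContDiffBump ((u₀ : (mixedSpace K)ˣ) : mixedSpace K) := ⟨ε / 4, ε / 2, by positivity, by linarith⟩
  refine ⟨fun x => ((b x : ℝ) : ℂ), ⟨?_, ?_, ?_⟩, ?_⟩
  · exact Complex.ofRealCLM.contDiff.comp b.contDiff
  · exact b.hasCompactSupport.comp_left Complex.ofReal_zero
  · have hs : Function.support (fun x => ((b x : ℝ) : ℂ)) = Function.support b :=
      Function.support_comp_eq Complex.ofReal (fun {x} => Complex.ofReal_eq_zero) b
    intro x hx
    have hx' : x ∈ tsupport b := by
      change x ∈ closure (Function.support fun x => ((b x : ℝ) : ℂ)) at hx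
      rwa [hs] at hx
    rw [b.tsupport_eq] at hx'
    refine hball (Metric.closedBall_subset_ball ?_ hx')
    change ε / 2 < ε
    linarith
  · have hmem : ∀ᶠ u : (mixedSpace K)ˣ in 𝓝 u₀, (u : mixedSpace K) ∈ Metric.ball ((u₀ : (mixedSpace K)ˣ) : mixedSpace K) (ε / 4) :=
      Units.continuous_val.continuousAt.preimage_mem_nhds (Metric.isOpen_ball.mem_nhds (Metric.mem_ball_self (by positivity)))
    filter_upwards [hmem] with u hu
    have h1 : b (u : mixedSpace K) = 1 := b.one_of_mem_closedBall (Metric.ball_subset_closedBall hu)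
    rw [h1, Complex.ofReal_one]

end Kernel

/-! ### 2–4. The torus smoothing -/

section Torus

variable {hcpt : isCompact_glFiniteIntegralLevel 2 K}
  {E : Type*} [NormedAddCommGroup E] [NormedSpace ℂ E] [CompleteSpace E]
  {τ : ContRepresentation ℂ (AutomorphyDatum.gl 2 K hcpt).arch.carrier E}

/-! ### 2. The exponential of the diagonal letters -/

/-- The unit `e^{x} ∈ K_∞ˣ` of the exponential of `x ∈ K_∞`. [folklore] -/
def mixedExpUnit (x : mixedSpace K) : (mixedSpace K)ˣ := (NormedSpace.isUnit_exp x).unit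

/-- `↑(mixedExpUnit x) = exp x`. [folklore] -/
@[simp] theorem coe_mixedExpUnit (x : mixedSpace K) : ((mixedExpUnit x : (mixedSpace K)ˣ) : mixedSpace K) = NormedSpace.exp x :=
  IsUnit.unit_spec _

/-- `exp(-x) exp(x) = 1` in the commutative Banach algebra `K_∞`. [folklore] -/
theorem exp_neg_mul_exp (x : mixedSpace K) : NormedSpace.exp (-x) * NormedSpace.exp x = 1 := by
  rw [← NormedSpace.exp_add_of_commute (Commute.all _ _), neg_add_cancel, NormedSpace.exp_zero]

/-- `↑(mixedExpUnit x)⁻¹ = exp(-x)`. [folklore] -/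
theorem coe_mixedExpUnit_inv (x : mixedSpace K) : (((mixedExpUnit x)⁻¹ : (mixedSpace K)ˣ) : mixedSpace K) = NormedSpace.exp (-x) := by
  refine Units.inv_eq_of_mul_eq_one_right ?_
  rw [coe_mixedExpUnit, ← NormedSpace.exp_add_of_commute (Commute.all _ _), add_neg_cancel, NormedSpace.exp_zero]

/-- `s ↦ e^{s a}` is continuous into `K_∞ˣ`. [folklore] -/
theorem continuous_mixedExpUnit_smul (a : mixedSpace K) : Continuous fun s : ℝ => mixedExpUnit (s • a) := by
  refine Units.continuous_iff.2 ⟨?_, ?_⟩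
  · have h : (Units.val ∘ fun s : ℝ => mixedExpUnit (s • a)) = fun s : ℝ => NormedSpace.exp (s • a) := funext fun s => coe_mixedExpUnit _
    rw [h]
    exact NormedSpace.exp_continuous.comp (continuous_id.smul continuous_const)
  · have h : (fun s : ℝ => (((mixedExpUnit (s • a))⁻¹ : (mixedSpace K)ˣ) : mixedSpace K)) = fun s : ℝ => NormedSpace.exp (-(s • a)) :=
      funext fun s => coe_mixedExpUnit_inv _
    rw [h]
    exact NormedSpace.exp_continuous.comp (continuous_id.smul continuous_const).neg

/-- **`e^{s E₀₀ ⊗ a} = a(e^{sa})`.** [folklore] -/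
theorem expGL_smul_single00 (a : mixedSpace K) (s : ℝ) :
    expGL (s • Matrix.single (0 : Fin 2) (0 : Fin 2) a) = diagGL2 (mixedExpUnit (s • a)) 1 := by
  refine Units.ext ?_
  rw [coe_expGL, coe_diagGL2, Matrix.smul_single, ← Matrix.diagonal_single, Matrix.exp_diagonal]
  refine Matrix.ext fun i j => ?_
  fin_cases i <;> fin_cases j
  · simp [Matrix.diagonal, coe_mixedExpUnit]
  · simp [Matrix.diagonal]
  · simp [Matrix.diagonal]
  · simp [Matrix.diagonal, NormedSpace.exp_zero]

omit [NumberField K] in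
/-- `a(w) a(u) = a(w u)`. [folklore] -/
theorem diagGL2_one_mul_diagGL2_one (w u : (mixedSpace K)ˣ) :
    diagGL2 w (1 : (mixedSpace K)ˣ) * diagGL2 u 1 = diagGL2 (w * u) 1 := by
  rw [← diagGL2_mul, mul_one]

/-! ### 3. The torus smoothing -/

variable [MeasurableSpace ((mixedSpace K)ˣ)] [BorelSpace ((mixedSpace K)ˣ)]

variable (hcpt τ) in
/-- **The torus smoothing** `S_A(φ) v = ∫ φ(u) • τ(a(u)) v dμ(u)`, `a(u) = diag(u, 1)`.
[cite: JacquetShalikaAJM1981, §3, (3.1)] -/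
def torusSmoothing (μ : Measure (mixedSpace K)ˣ) (φ : mixedSpace K → ℂ) (v : E) : E :=
  ∫ u, φ (u : mixedSpace K) • τ (toArch hcpt (diagGL2 u 1)) v ∂μ

variable (μ : Measure (mixedSpace K)ˣ)

omit [CompleteSpace E] in
/-- The integrand of `S_A(φ) v` is integrable for `φ` continuous and compactly supported on the units.
[folklore] -/
theorem integrable_torusSmoothing_integrand [IsFiniteMeasureOnCompacts μ] (hτ : τ.IsStronglyContinuous)
    {φ : mixedSpace K → ℂ} (hφc : Continuous φ) (hφs : HasCompactSupport fun u : (mixedSpace K)ˣ => φ (u : mixedSpace K)) (v : E) :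
    Integrable (fun u : (mixedSpace K)ˣ => φ (u : mixedSpace K) • τ (toArch hcpt (diagGL2 u 1)) v) μ :=
  ((hφc.comp Units.continuous_val).smul ((continuous_apply_toArch hcpt τ hτ v).comp
    (continuous_diagGL2.comp (continuous_id.prodMk continuous_const)))).integrable_of_hasCompactSupport hφs.smul_right

omit [CompleteSpace E] in
/-- `‖S_A(φ) v‖ ≤ ‖φ‖_{L¹(μ)} ‖v‖` for `‖τ(·)‖ ≤ 1`. [folklore] -/
theorem norm_torusSmoothing_le [IsFiniteMeasureOnCompacts μ] (hτ : τ.IsStronglyContinuous) (hτb : ∀ g, ‖(τ g : E →L[ℂ] E)‖ ≤ 1)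
    {φ : mixedSpace K → ℂ} (hφc : Continuous φ) (hφs : HasCompactSupport fun u : (mixedSpace K)ˣ => φ (u : mixedSpace K)) (v : E) :
    ‖torusSmoothing hcpt τ μ φ v‖ ≤ (∫ u, ‖φ (u : mixedSpace K)‖ ∂μ) * ‖v‖ := by
  unfold torusSmoothing
  have hint := integrable_torusSmoothing_integrand μ hτ hφc hφs v
  have hint' : Integrable (fun u : (mixedSpace K)ˣ => ‖φ (u : mixedSpace K)‖ * ‖v‖) μ :=
    ((hφc.comp Units.continuous_val).norm.integrable_of_hasCompactSupport hφs.norm).mul_const _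
  calc ‖∫ u, φ (u : mixedSpace K) • τ (toArch hcpt (diagGL2 u 1)) v ∂μ‖
        ≤ ∫ u, ‖φ (u : mixedSpace K) • τ (toArch hcpt (diagGL2 u 1)) v‖ ∂μ := norm_integral_le_integral_norm _
    _ ≤ ∫ u, ‖φ (u : mixedSpace K)‖ * ‖v‖ ∂μ := by
        refine integral_mono hint.norm hint' fun u => ?_
        rw [_root_.norm_smul]
        refine mul_le_mul_of_nonneg_left ?_ (norm_nonneg _)
        exact (ContinuousLinearMap.le_opNorm _ _).trans (by nlinarith [hτb (toArch hcpt (diagGL2 u 1)), norm_nonneg v])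
    _ = (∫ u, ‖φ (u : mixedSpace K)‖ ∂μ) * ‖v‖ := integral_mul_const _ _

/-- **`S_A(φ)` preserves the Gårding space.** [cite: JacquetShalikaAJM1981, §3, (3.1)] -/
theorem torusSmoothing_mem_archGardingSpace [IsFiniteMeasureOnCompacts μ] (hτ : τ.IsStronglyContinuous)
    (hτb : ∀ g, ‖(τ g : E →L[ℂ] E)‖ ≤ 1) {φ : mixedSpace K → ℂ} (hφc : Continuous φ)
    (hφs : HasCompactSupport fun u : (mixedSpace K)ˣ => φ (u : mixedSpace K)) {v : E} (hv : v ∈ archGardingSpace hcpt τ) :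
    torusSmoothing hcpt τ μ φ v ∈ archGardingSpace hcpt τ :=
  weightedIntegral_apply_toArch_mem_archGardingSpace μ (continuous_diagGL2.comp (continuous_id.prodMk continuous_const))
    (hφc.comp Units.continuous_val) hφs hτ hτb hv

/-! ### 4. Absorption of the diagonal letters -/

/-- **Absorption of the diagonal letters into the torus kernel**: for a torus kernel `φ`, a measure
`μ` on `K_∞ˣ` finite on compacts and left invariant, and EVERY `v ∈ E`,
`τ(E₀₀ ⊗ a) S_A(φ) v = S_A(φ_a) v` with `φ_a(x) = -∂φ(x)(a x)`:
`τ(a(e^{sa})) S_A(φ) v = ∫ φ(e^{-sa} u) τ(a(u)) v dμ(u)` by left invariance, then differentiate under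
the integral sign at `s = 0`. [cite: JacquetShalikaAJM1981, §3, (3.2)] -/
theorem archDerivE_single00_torusSmoothing [IsFiniteMeasureOnCompacts μ] [μ.IsMulLeftInvariant] (hτ : τ.IsStronglyContinuous)
    (hτb : ∀ g, ‖(τ g : E →L[ℂ] E)‖ ≤ 1) {φ : mixedSpace K → ℂ} (hφ : IsTorusKernel K φ) (a : mixedSpace K) (v : E) :
    archDerivE hcpt τ (Matrix.single 0 0 a) (torusSmoothing hcpt τ μ φ v) =
      torusSmoothing hcpt τ μ (fun x => -(fderiv ℝ φ x (a * x))) v := by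
  have hφc := hφ.continuous
  have hφs := hφ.hasCompactSupport_comp_val
  have hφa := hφ.eulerDeriv a
  have hdiag : Continuous fun u : (mixedSpace K)ˣ => (diagGL2 u 1 : GL (Fin 2) (mixedSpace K)) :=
    continuous_diagGL2.comp (continuous_id.prodMk continuous_const)
  -- `τ(a(e^{sa})) S_A(φ) v = ∫ φ(e^{-sa} u) • τ(a u) v dμ`
  have htrans : ∀ s : ℝ, τ (toArch hcpt (expGL (s • Matrix.single (0 : Fin 2) (0 : Fin 2) a))) (torusSmoothing hcpt τ μ φ v) =
      ∫ u, φ (NormedSpace.exp (s • (-a)) * (u : mixedSpace K)) • τ (toArch hcpt (diagGL2 u 1)) v ∂μ := by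
    intro s
    unfold torusSmoothing
    rw [← ContinuousLinearMap.integral_comp_comm _ (integrable_torusSmoothing_integrand μ hτ hφc hφs v), expGL_smul_single00]
    have h1 : (fun u : (mixedSpace K)ˣ => τ (toArch hcpt (diagGL2 (mixedExpUnit (s • a)) 1)) (φ (u : mixedSpace K) • τ (toArch hcpt (diagGL2 u 1)) v)) =
        fun u => (fun u' : (mixedSpace K)ˣ => φ (NormedSpace.exp (s • (-a)) * (u' : mixedSpace K)) • τ (toArch hcpt (diagGL2 u' 1)) v)
          (mixedExpUnit (s • a) * u) := by
      funext u
      dsimp only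
      rw [map_smul, ← ContinuousLinearMap.comp_apply, ← ContinuousLinearMap.mul_def, ← map_mul]
      have hmul : toArch hcpt (diagGL2 (mixedExpUnit (s • a)) 1) * toArch hcpt (diagGL2 u 1) = toArch hcpt (diagGL2 (mixedExpUnit (s • a) * u) 1) :=
        Subtype.ext (diagGL2_one_mul_diagGL2_one _ _)
      rw [hmul, Units.val_mul, coe_mixedExpUnit, ← mul_assoc, smul_neg, exp_neg_mul_exp, one_mul]
    rw [h1]
    exact integral_mul_left_eq_self (μ := μ)
      (fun u' : (mixedSpace K)ˣ => φ (NormedSpace.exp (s • (-a)) * (u' : mixedSpace K)) • τ (toArch hcpt (diagGL2 u' 1)) v) (mixedExpUnit (s • a))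
  -- differentiate under the integral sign at `s = 0`
  set F : ℝ → (mixedSpace K)ˣ → E := fun s u => φ (NormedSpace.exp (s • (-a)) * (u : mixedSpace K)) • τ (toArch hcpt (diagGL2 u 1)) v with hF
  set F' : ℝ → (mixedSpace K)ˣ → E := fun s u =>
    (fderiv ℝ φ (NormedSpace.exp (s • (-a)) * (u : mixedSpace K)) ((-a) * NormedSpace.exp (s • (-a)) * (u : mixedSpace K))) •
      τ (toArch hcpt (diagGL2 u 1)) v with hF'
  -- the compact set carrying `F' s` for `|s| ≤ 1`
  set S : Set (mixedSpace K)ˣ := (Units.val : (mixedSpace K)ˣ → mixedSpace K) ⁻¹' tsupport φ with hS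
  have hSc : IsCompact S := hφ.isCompact_preimage_val
  set T : Set (mixedSpace K)ˣ := (fun p : ℝ × (mixedSpace K)ˣ => mixedExpUnit (p.1 • a) * p.2) '' (Metric.closedBall (0 : ℝ) 1 ×ˢ S) with hT
  have hTc : IsCompact T :=
    ((isCompact_closedBall (0 : ℝ) 1).prod hSc).image (((continuous_mixedExpUnit_smul a).comp continuous_fst).mul continuous_snd)
  have hF'zero : ∀ s ∈ Metric.ball (0 : ℝ) 1, ∀ u ∉ T, F' s u = 0 := by
    intro s hs u hu
    have hnot : NormedSpace.exp (s • (-a)) * (u : mixedSpace K) ∉ tsupport φ := by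
      intro hmem
      apply hu
      refine ⟨(s, (mixedExpUnit (s • a))⁻¹ * u), ⟨Metric.ball_subset_closedBall hs, ?_⟩, ?_⟩
      · change (((mixedExpUnit (s • a))⁻¹ * u : (mixedSpace K)ˣ) : mixedSpace K) ∈ tsupport φ
        rwa [Units.val_mul, coe_mixedExpUnit_inv, ← smul_neg]
      · change mixedExpUnit (s • a) * ((mixedExpUnit (s • a))⁻¹ * u) = u
        rw [mul_inv_cancel_left]
    have h0 : fderiv ℝ φ (NormedSpace.exp (s • (-a)) * (u : mixedSpace K)) = 0 := by
      by_contra hne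
      exact hnot (support_fderiv_subset ℝ (Function.mem_support.2 hne))
    simp only [hF']
    rw [h0]
    simp
  -- a uniform bound on `T`
  obtain ⟨C₁, hC₁⟩ := (hφ.hasCompactSupport.fderiv (𝕜 := ℝ)).exists_bound_of_continuous hφ.continuous_fderiv
  obtain ⟨C₂, hC₂⟩ := ((isCompact_closedBall (0 : ℝ) 1).prod hTc).exists_bound_of_continuousOn
    (f := fun p : ℝ × (mixedSpace K)ˣ => (-a) * NormedSpace.exp (p.1 • (-a)) * (p.2 : mixedSpace K))
    (((continuous_const.mul (NormedSpace.exp_continuous.comp (continuous_fst.smul continuous_const))).mul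
      (Units.continuous_val.comp continuous_snd)).continuousOn)
  have hC₁0 : 0 ≤ C₁ := (norm_nonneg _).trans (hC₁ 0)
  have hFc : ∀ s, Continuous (F s) := fun s =>
    (hφc.comp (continuous_const.mul Units.continuous_val)).smul ((continuous_apply_toArch hcpt τ hτ v).comp hdiag)
  have hF'c : ∀ s, Continuous (F' s) := fun s =>
    ((hφ.continuous_fderiv.comp (continuous_const.mul Units.continuous_val)).clm_apply
      (continuous_const.mul Units.continuous_val)).smul ((continuous_apply_toArch hcpt τ hτ v).comp hdiag)
  have hint : Integrable (F 0) μ := by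
    have : F 0 = fun u : (mixedSpace K)ˣ => φ (u : mixedSpace K) • τ (toArch hcpt (diagGL2 u 1)) v := by
      funext u; simp [hF]
    rw [this]; exact integrable_torusSmoothing_integrand μ hτ hφc hφs v
  have hbound : ∀ᵐ u ∂μ, ∀ s ∈ Metric.ball (0 : ℝ) 1, ‖F' s u‖ ≤ T.indicator (fun _ => C₁ * C₂ * ‖v‖) u := by
    refine ae_of_all _ fun u s hs => ?_
    by_cases hu : u ∈ T
    · rw [indicator_of_mem hu]
      change ‖(fderiv ℝ φ (NormedSpace.exp (s • (-a)) * (u : mixedSpace K)) ((-a) * NormedSpace.exp (s • (-a)) * (u : mixedSpace K))) •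
        τ (toArch hcpt (diagGL2 u 1)) v‖ ≤ C₁ * C₂ * ‖v‖
      rw [_root_.norm_smul]
      have h2 : ‖(-a) * NormedSpace.exp (s • (-a)) * (u : mixedSpace K)‖ ≤ C₂ :=
        hC₂ (s, u) ⟨Metric.ball_subset_closedBall hs, hu⟩
      have hC₂0 : 0 ≤ C₂ := (norm_nonneg _).trans h2
      refine mul_le_mul ((ContinuousLinearMap.le_opNorm _ _).trans (mul_le_mul (hC₁ _) h2 (norm_nonneg _) hC₁0)) ?_
        (norm_nonneg _) (mul_nonneg hC₁0 hC₂0)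
      exact (ContinuousLinearMap.le_opNorm _ _).trans (by nlinarith [hτb (toArch hcpt (diagGL2 u 1)), norm_nonneg v])
    · rw [indicator_of_notMem hu, hF'zero s hs u hu, norm_zero]
  have hdiff : ∀ᵐ u ∂μ, ∀ s ∈ Metric.ball (0 : ℝ) 1, HasDerivAt (fun s => F s u) (F' s u) s := by
    refine ae_of_all _ fun u s _ => ?_
    have h1 : HasDerivAt (fun s : ℝ => NormedSpace.exp (s • (-a)) * (u : mixedSpace K))
        ((-a) * NormedSpace.exp (s • (-a)) * (u : mixedSpace K)) s :=
      (hasDerivAt_exp_smul_const' (𝕂 := ℝ) (-a) s).mul_const _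
    have h2 : HasDerivAt (fun s : ℝ => φ (NormedSpace.exp (s • (-a)) * (u : mixedSpace K)))
        (fderiv ℝ φ (NormedSpace.exp (s • (-a)) * (u : mixedSpace K)) ((-a) * NormedSpace.exp (s • (-a)) * (u : mixedSpace K))) s :=
      (hφ.differentiable _).hasFDerivAt.comp_hasDerivAt s h1
    exact h2.smul_const (τ (toArch hcpt (diagGL2 u 1)) v)
  have key := (hasDerivAt_integral_of_dominated_loc_of_deriv_le (μ := μ) (F := F) (F' := F')
    (x₀ := (0 : ℝ)) (Metric.ball_mem_nhds (0 : ℝ) one_pos) (Eventually.of_forall fun s => (hFc s).aestronglyMeasurable) hint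
    (hF'c 0).aestronglyMeasurable hbound ((integrable_indicator_iff hTc.isClosed.measurableSet).2 (integrableOn_const hTc.measure_lt_top.ne))
    hdiff).2
  -- conclude
  unfold archDerivE
  have hfun : (fun s : ℝ => τ (toArch hcpt (expGL (s • Matrix.single (0 : Fin 2) (0 : Fin 2) a))) (torusSmoothing hcpt τ μ φ v)) =
      fun s => ∫ u, F s u ∂μ := by
    funext s; rw [htrans s]
  rw [hfun, key.deriv]
  unfold torusSmoothing
  refine integral_congr_ae (Eventually.of_forall fun u => ?_)
  simp only [hF', zero_smul, NormedSpace.exp_zero, mul_one, one_mul, neg_mul, map_neg, neg_smul]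

end Torus

/-! ### 5. Whittaker-type functionals and `S_A(φ)` -/

section Whittaker

variable {hcpt : isCompact_glFiniteIntegralLevel 2 K}
  {E : Type*} [NormedAddCommGroup E] [InnerProductSpace ℂ E] [CompleteSpace E]
  {τ : ContRepresentation ℂ (AutomorphyDatum.gl 2 K hcpt).arch.carrier E}

variable (K) in
/-- The `(0,0)`-entry of a matrix, inverting `u ↦ a(u)` on the torus. [folklore] -/
def entry00 (h : GL (Fin 2) (mixedSpace K)) : mixedSpace K := (h : Matrix (Fin 2) (Fin 2) (mixedSpace K)) 0 0

omit [NumberField K] in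
/-- `entry00 (a(u)) = u`. [folklore] -/
@[simp] theorem entry00_diagGL2 (u u' : (mixedSpace K)ˣ) : entry00 K (diagGL2 u u') = (u : mixedSpace K) := by
  simp [entry00, coe_diagGL2]

omit [NumberField K] in
/-- `entry00` is continuous. [folklore] -/
theorem continuous_entry00 : Continuous (entry00 K) :=
  (Units.continuous_val (M := Matrix (Fin 2) (Fin 2) (mixedSpace K))).matrix_elem 0 0

variable [MeasurableSpace ((mixedSpace K)ˣ)] [BorelSpace ((mixedSpace K)ˣ)]

/-- **A Sobolev-bounded functional sees `S_A(φ) v` as `∫ φ W_v dμ`**: for `v ∈ 𝒢`,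
`ℓ(S_A(φ) v) = ∫ φ(u) W_v(u) dμ(u)`, `W_v(u) = ℓ(τ(a(u)) v)` the Kirillov function
(exchange lemma `apply_integral_apply_toArch_eq_integral` for the finite measure `a_*(μ|_{supp φ})`).
[cite: JacquetShalikaAJM1981, §3, (3.16)] -/
theorem apply_torusSmoothing_eq (μ : Measure (mixedSpace K)ˣ) [IsFiniteMeasureOnCompacts μ] (hτu : ∀ g, ‖(τ g : E →L[ℂ] E)‖ ≤ 1)
    (hτ : τ.IsStronglyContinuous) {ℓ : archGardingSpace hcpt τ →ₗ[ℂ] ℂ}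
    (hℓ : ∃ (C : ℝ) (𝒮 : Finset (List (Matrix (Fin 2) (Fin 2) (mixedSpace K)))), 0 ≤ C ∧
      ∀ v : archGardingSpace hcpt τ, ‖ℓ v‖ ≤ C * ∑ w ∈ 𝒮, ‖archWordDerivE hcpt τ w v‖)
    {φ : mixedSpace K → ℂ} (hφc : Continuous φ) (hφs : HasCompactSupport fun u : (mixedSpace K)ˣ => φ (u : mixedSpace K))
    (v : archGardingSpace hcpt τ) :
    ℓ ⟨torusSmoothing hcpt τ μ φ v, torusSmoothing_mem_archGardingSpace μ hτ hτu hφc hφs v.2⟩ =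
      ∫ u, φ (u : mixedSpace K) * kirillovFn hτ ℓ v u ∂μ := by
  set c : (mixedSpace K)ˣ → GL (Fin 2) (mixedSpace K) := fun u => diagGL2 u 1 with hc
  have hcc : Continuous c := continuous_diagGL2.comp (continuous_id.prodMk continuous_const)
  set S : Set (mixedSpace K)ˣ := tsupport fun u : (mixedSpace K)ˣ => φ (u : mixedSpace K) with hSdef
  have hSc : IsCompact S := hφs
  set ν : Measure (GL (Fin 2) (mixedSpace K)) := (μ.restrict S).map c with hν
  haveI : IsFiniteMeasure (μ.restrict S) := ⟨by rw [Measure.restrict_apply_univ]; exact hSc.measure_lt_top⟩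
  haveI : IsFiniteMeasure ν := by rw [hν]; infer_instance
  have hκ : IsCompact (c '' S) := hSc.image hcc
  have hνκ : ∀ᵐ h ∂ν, h ∈ c '' S := by
    rw [hν]
    refine (ae_map_iff hcc.measurable.aemeasurable hκ.isClosed.measurableSet).2 ?_
    rw [ae_restrict_iff' (isClosed_tsupport _).measurableSet]
    exact ae_of_all _ fun u hu => ⟨u, hu, rfl⟩
  -- the family `h ↦ φ(h₀₀) • v`
  set G : GL (Fin 2) (mixedSpace K) → ℂ := fun h => φ (entry00 K h) with hG
  have hGc : Continuous G := hφc.comp continuous_entry00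
  have hGc' : ∀ u : (mixedSpace K)ˣ, G (c u) = φ (u : mixedSpace K) := by
    intro u
    simp only [hG, hc, entry00_diagGL2]
  have hx : IsGardingContComb hcpt τ (fun h : GL (Fin 2) (mixedSpace K) => G h • (v : E)) := (isGardingContComb_const v.2).smul hGc
  -- `S_A(φ) v` as a `ν`-smoothing
  have hrepr : torusSmoothing hcpt τ μ φ v = ∫ h, τ (toArch hcpt h) (G h • (v : E)) ∂ν := by
    unfold torusSmoothing
    rw [hν, integral_map (f := fun h => τ (toArch hcpt h) (G h • (v : E))) hcc.measurable.aemeasurable]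
    · symm
      refine (setIntegral_eq_integral_of_forall_compl_eq_zero fun u hu => ?_).trans ?_
      · rw [hGc' u, image_eq_zero_of_notMem_tsupport hu, zero_smul, map_zero]
      · exact integral_congr_ae (Eventually.of_forall fun u => by simp only [hGc' u, map_smul]; rfl)
    · exact (by simpa only [one_mul] using continuous_apply_toArch_mul_comb hτ hx 1 :
        Continuous fun h => τ (toArch hcpt h) (G h • (v : E))).aestronglyMeasurable
  have hS' : ∫ h, τ (toArch hcpt h) (G h • (v : E)) ∂ν ∈ archGardingSpace hcpt τ := by
    rw [← hrepr]; exact torusSmoothing_mem_archGardingSpace μ hτ hτu hφc hφs v.2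
  have key := apply_integral_apply_toArch_eq_integral hτ hτu ν hκ hνκ hx hℓ hS'
  have hsub : (⟨torusSmoothing hcpt τ μ φ v, torusSmoothing_mem_archGardingSpace μ hτ hτu hφc hφs v.2⟩ : archGardingSpace hcpt τ) =
      ⟨_, hS'⟩ := Subtype.ext hrepr
  rw [hsub, key]
  have hval : ∀ h, ℓ ⟨τ (toArch hcpt h) (G h • (v : E)), apply_mem_archGardingSpace hτ _ (hx.mem h)⟩ =
      G h * ℓ ⟨τ (toArch hcpt h) (v : E), apply_mem_archGardingSpace hτ _ v.2⟩ := by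
    intro h
    rw [← smul_eq_mul, ← map_smul]
    congr 1
    exact Subtype.ext (by simp)
  simp_rw [hval]
  rw [hν, integral_map hcc.measurable.aemeasurable]
  · simp_rw [hGc']
    refine (setIntegral_eq_integral_of_forall_compl_eq_zero fun u hu => ?_).trans ?_
    · rw [image_eq_zero_of_notMem_tsupport hu, zero_mul]
    · exact integral_congr_ae (Eventually.of_forall fun u => rfl)
  · have hc' : Continuous fun h : GL (Fin 2) (mixedSpace K) => G h * ℓ ⟨τ (toArch hcpt h) (v : E), apply_mem_archGardingSpace hτ _ v.2⟩ :=
      hGc.mul (continuous_apply_toArch_functional hτ hℓ v.2 continuous_id)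
    exact hc'.aestronglyMeasurable

end Whittaker

end Literature.NumberTheory.Automorphic
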